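import Mathlib
import HarnessLib
import Summits.HubbardSuperconductivity.HubbardSuperconductivity.Theorems.KLProgrammeH10TwoPointLimitPerturbedCountFoldThin

/-!
# Route `KLProgramme` — K3 engine child `KLRegimeEngineV17F2` (stmt-HubbardSuperconductivity-20437), stub (b) import ι₂:
# the thin fold-range total is `O(1/w)` — the `w`-free constant

Cell gate-hubbard-kl, plan g17 (R41)(i) «E1-P2-THIN-COUNT» (seat p4; part (F3c), corollary).  `count_anti_total_thin_perturbed` bounds the fold ranges of the
anchored four-leg count by the two-regime expression of `sum_rows_two_regime_le`; at the scaling of the thin tolerance — `δ₁ = K₃·w`, `δ_M = C₀w² + C₂w·m_M`,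
rows of width `w/2`, `4N = 8π/w` rows, `w ≤ 1` — every term of that expression is `≤ const/w`.  This file records the `w`-free constant:

* **`count_anti_total_thin_perturbed_le_div`** — the fold-range total is `≤ K_F3 / w` with `K_F3` explicit in the `BandBounds` fields, the named perturbed
  constants `pc*`, and `(C₀, C₂, K₃, m_M, τ, λ, η₀F, η₀″, η₀S, η₁S, R)` — NO `J + 1`, NO `log N`.

Everything is PROVED; no definitions.  References: BGM 2006 Lemma 3.1 / (2.80) / App. A2–A3 [cite: BenfattoGiulianiMastropietro2006]; Mastropietro 2008 (14.67)
p. 223 [cite: Mastropietro2008].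
-/

noncomputable section

namespace Summit.HubbardSuperconductivity.HubbardSuperconductivity.Theorems.PerturbedFermiCurve

set_option linter.dupNamespace false -- summit = problem name (single-conjunct summit), D-0017

open Real Set
open Literature.MathematicalPhysics.QuantumLattice Literature.MathematicalPhysics.QuantumLattice.BandSectorCounting

/-- The `w`-bookkeeping of the two-regime bound (pure algebra): with `N' = 8π/w` rows, `h = w/2`, `c = h_min/2`, `δ₁ = K₃w`, `δ_M ≤ w·D₁`, `η_B ≤ w·D₂`,
`0 < w ≤ 1`, the expression of `sum_rows_two_regime_le` is `≤ K/w`. [folklore] -/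
theorem two_regime_bound_le_div {w Pc K₃ hm M η₀'' C₀ C₂ cQ δM Λ X Y Z ηB R D₁ D₂ N' : ℝ} (hw : 0 < w) (hw1 : w ≤ 1)
    (hPc : 0 ≤ Pc) (hhm : 0 < hm) (hM : 0 < M) (hη₀'' : 0 < η₀'') (hC₀ : 0 < C₀)
    (hX : 0 ≤ X) (hY : 0 ≤ Y) (hZ : 0 ≤ Z) (hR : 0 < R) (hD₂ : 0 < D₂)
    (hN' : N' = 8 * π / w) (hδM : δM ≤ w * D₁) (hηB : ηB ≤ w * D₂)
    (hΛ : Λ ≤ X * ηB / w + Y * Real.sqrt ηB / w + Z) :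
    N' * ((2 * Pc + 4 * Pc * (K₃ * w) / (hm / 2 * w)) + (2 * Pc / w) * (2 * δM * Real.sqrt (2 * M) / (hm / 2 * Real.sqrt η₀'')) +
          (4 * Pc * Real.sqrt (2 * M) / (hm / 2)) * (Real.sqrt (C₀ / 2) + C₂ / Real.sqrt cQ)) +
        (2 * Pc / w) * (2 * Real.sqrt (δM / (hm / 2))) * Λ +
        (2 * Pc / w) * (2 * δM * Real.sqrt (2 * M) / (hm / 2)) * ((4 * (N' * (w / 2)) / R + 1) * (4 / Real.sqrt (2 * C₀ * w ^ 2) + 11 / (Real.sqrt (2 * hm) * (w / 2)))) ≤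
      (8 * π * ((2 * Pc + 8 * Pc * K₃ / hm) + 8 * Pc * D₁ * Real.sqrt (2 * M) / (hm * Real.sqrt η₀'') +
            (8 * Pc * Real.sqrt (2 * M) / hm) * (Real.sqrt (C₀ / 2) + C₂ / Real.sqrt cQ)) +
          4 * Pc * Real.sqrt (2 * D₁ / hm) * (X * D₂ + Z + Y * Real.sqrt D₂) +
          (8 * Pc * D₁ * Real.sqrt (2 * M) / hm) * ((16 * π / R + 1) * (4 / Real.sqrt (2 * C₀) + 22 / Real.sqrt (2 * hm)))) / w := by
  have hπ := Real.pi_pos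
  have hsw : 0 < Real.sqrt w := Real.sqrt_pos.2 hw
  have hsw1 : Real.sqrt w ≤ 1 := by rw [← Real.sqrt_one]; exact Real.sqrt_le_sqrt hw1
  have hww : Real.sqrt w * Real.sqrt w = w := Real.mul_self_sqrt hw.le
  -- term 1: the row constants
  have t1 : N' * ((2 * Pc + 4 * Pc * (K₃ * w) / (hm / 2 * w)) + (2 * Pc / w) * (2 * δM * Real.sqrt (2 * M) / (hm / 2 * Real.sqrt η₀'')) +
        (4 * Pc * Real.sqrt (2 * M) / (hm / 2)) * (Real.sqrt (C₀ / 2) + C₂ / Real.sqrt cQ)) ≤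
      8 * π * ((2 * Pc + 8 * Pc * K₃ / hm) + 8 * Pc * D₁ * Real.sqrt (2 * M) / (hm * Real.sqrt η₀'') +
        (8 * Pc * Real.sqrt (2 * M) / hm) * (Real.sqrt (C₀ / 2) + C₂ / Real.sqrt cQ)) / w := by
    have e1 : 2 * Pc + 4 * Pc * (K₃ * w) / (hm / 2 * w) = 2 * Pc + 8 * Pc * K₃ / hm := by field_simp; ring
    have e2 : (2 * Pc / w) * (2 * δM * Real.sqrt (2 * M) / (hm / 2 * Real.sqrt η₀'')) ≤ 8 * Pc * D₁ * Real.sqrt (2 * M) / (hm * Real.sqrt η₀'') := by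
      have hsη := Real.sqrt_pos.2 hη₀''
      rw [show (2 * Pc / w) * (2 * δM * Real.sqrt (2 * M) / (hm / 2 * Real.sqrt η₀'')) =
        (8 * Pc * Real.sqrt (2 * M) / (hm * Real.sqrt η₀'')) * (δM / w) by field_simp; ring]
      rw [show 8 * Pc * D₁ * Real.sqrt (2 * M) / (hm * Real.sqrt η₀'') = (8 * Pc * Real.sqrt (2 * M) / (hm * Real.sqrt η₀'')) * D₁ by ring]
      refine mul_le_mul_of_nonneg_left ?_ (by positivity)
      rw [div_le_iff₀ hw]; linarith
    have e3 : (4 * Pc * Real.sqrt (2 * M) / (hm / 2)) = 8 * Pc * Real.sqrt (2 * M) / hm := by field_simp; ring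
    rw [e1, e3, hN']
    rw [show 8 * π / w * ((2 * Pc + 8 * Pc * K₃ / hm) + (2 * Pc / w) * (2 * δM * Real.sqrt (2 * M) / (hm / 2 * Real.sqrt η₀'')) +
        8 * Pc * Real.sqrt (2 * M) / hm * (Real.sqrt (C₀ / 2) + C₂ / Real.sqrt cQ)) =
      8 * π * ((2 * Pc + 8 * Pc * K₃ / hm) + (2 * Pc / w) * (2 * δM * Real.sqrt (2 * M) / (hm / 2 * Real.sqrt η₀'')) +
        8 * Pc * Real.sqrt (2 * M) / hm * (Real.sqrt (C₀ / 2) + C₂ / Real.sqrt cQ)) / w by ring]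
    refine div_le_div_of_nonneg_right ?_ hw.le
    refine mul_le_mul_of_nonneg_left ?_ (by positivity)
    linarith
  -- term 2: the fat level
  have t2 : (2 * Pc / w) * (2 * Real.sqrt (δM / (hm / 2))) * Λ ≤ 4 * Pc * Real.sqrt (2 * D₁ / hm) * (X * D₂ + Z + Y * Real.sqrt D₂) / w := by
    have hsq1 : Real.sqrt (δM / (hm / 2)) ≤ Real.sqrt w * Real.sqrt (2 * D₁ / hm) := by
      rw [← Real.sqrt_mul hw.le]
      exact Real.sqrt_le_sqrt (by rw [div_le_iff₀ (by positivity)]; field_simp; nlinarith)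
    have hΛ' : Λ ≤ X * D₂ + Z + Y * Real.sqrt D₂ / Real.sqrt w := by
      have a1 : X * ηB / w ≤ X * D₂ := by
        rw [div_le_iff₀ hw]; nlinarith
      have a2 : Y * Real.sqrt ηB / w ≤ Y * Real.sqrt D₂ / Real.sqrt w := by
        have : Real.sqrt ηB ≤ Real.sqrt w * Real.sqrt D₂ := by
          rw [← Real.sqrt_mul hw.le]; exact Real.sqrt_le_sqrt hηB
        rw [div_le_div_iff₀ hw hsw]
        calc Y * Real.sqrt ηB * Real.sqrt w ≤ Y * (Real.sqrt w * Real.sqrt D₂) * Real.sqrt w := by gcongr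
          _ = Y * Real.sqrt D₂ * (Real.sqrt w * Real.sqrt w) := by ring
          _ = Y * Real.sqrt D₂ * w := by rw [hww]
      linarith
    have hΛ0 : 0 ≤ X * D₂ + Z + Y * Real.sqrt D₂ / Real.sqrt w := by positivity
    calc (2 * Pc / w) * (2 * Real.sqrt (δM / (hm / 2))) * Λ
        ≤ (2 * Pc / w) * (2 * (Real.sqrt w * Real.sqrt (2 * D₁ / hm))) * (X * D₂ + Z + Y * Real.sqrt D₂ / Real.sqrt w) := by
          have hΛle : (2 * Pc / w) * (2 * Real.sqrt (δM / (hm / 2))) * Λ ≤ (2 * Pc / w) * (2 * Real.sqrt (δM / (hm / 2))) * (X * D₂ + Z + Y * Real.sqrt D₂ / Real.sqrt w) := by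
            by_cases h0 : Λ ≤ 0
            · have : (2 * Pc / w) * (2 * Real.sqrt (δM / (hm / 2))) * Λ ≤ 0 :=
                mul_nonpos_of_nonneg_of_nonpos (by positivity) h0
              have : 0 ≤ (2 * Pc / w) * (2 * Real.sqrt (δM / (hm / 2))) * (X * D₂ + Z + Y * Real.sqrt D₂ / Real.sqrt w) := by positivity
              linarith
            · exact mul_le_mul_of_nonneg_left hΛ' (by positivity)
          refine hΛle.trans ?_
          exact mul_le_mul_of_nonneg_right (mul_le_mul_of_nonneg_left (by linarith) (by positivity)) hΛ0
      _ = 4 * Pc * Real.sqrt (2 * D₁ / hm) * ((X * D₂ + Z) * Real.sqrt w + Y * Real.sqrt D₂) / w := by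
          field_simp
          ring
      _ ≤ 4 * Pc * Real.sqrt (2 * D₁ / hm) * (X * D₂ + Z + Y * Real.sqrt D₂) / w := by
          refine div_le_div_of_nonneg_right (mul_le_mul_of_nonneg_left ?_ (by positivity)) hw.le
          have : (X * D₂ + Z) * Real.sqrt w ≤ (X * D₂ + Z) * 1 := mul_le_mul_of_nonneg_left hsw1 (by positivity)
          linarith
  -- term 3: the arcsine blocks
  have t3 : (2 * Pc / w) * (2 * δM * Real.sqrt (2 * M) / (hm / 2)) * ((4 * (N' * (w / 2)) / R + 1) *
        (4 / Real.sqrt (2 * C₀ * w ^ 2) + 11 / (Real.sqrt (2 * hm) * (w / 2)))) ≤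
      (8 * Pc * D₁ * Real.sqrt (2 * M) / hm) * ((16 * π / R + 1) * (4 / Real.sqrt (2 * C₀) + 22 / Real.sqrt (2 * hm))) / w := by
    have e1 : 4 * (N' * (w / 2)) / R + 1 = 16 * π / R + 1 := by rw [hN']; field_simp; ring
    have e2 : 4 / Real.sqrt (2 * C₀ * w ^ 2) + 11 / (Real.sqrt (2 * hm) * (w / 2)) = (4 / Real.sqrt (2 * C₀) + 22 / Real.sqrt (2 * hm)) / w := by
      rw [show 2 * C₀ * w ^ 2 = (2 * C₀) * w ^ 2 by ring, Real.sqrt_mul (by positivity), Real.sqrt_sq hw.le]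
      field_simp
      ring
    have e3 : (2 * Pc / w) * (2 * δM * Real.sqrt (2 * M) / (hm / 2)) = (8 * Pc * Real.sqrt (2 * M) / hm) * (δM / w) := by field_simp; ring
    rw [e1, e2, e3]
    have hblk : 0 ≤ (16 * π / R + 1) * ((4 / Real.sqrt (2 * C₀) + 22 / Real.sqrt (2 * hm)) / w) := by positivity
    have hd : δM / w ≤ D₁ := by rw [div_le_iff₀ hw]; linarith
    calc (8 * Pc * Real.sqrt (2 * M) / hm) * (δM / w) * ((16 * π / R + 1) * ((4 / Real.sqrt (2 * C₀) + 22 / Real.sqrt (2 * hm)) / w))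
        ≤ (8 * Pc * Real.sqrt (2 * M) / hm) * D₁ * ((16 * π / R + 1) * ((4 / Real.sqrt (2 * C₀) + 22 / Real.sqrt (2 * hm)) / w)) :=
          mul_le_mul_of_nonneg_right (mul_le_mul_of_nonneg_left hd (by positivity)) hblk
      _ = _ := by field_simp
  rw [add_div, add_div]
  linarith [t1, t2, t3]

end Summit.HubbardSuperconductivity.HubbardSuperconductivity.Theorems.PerturbedFermiCurve

end
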